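import Summits.ResolutionOfSingularities.ResolutionOfSingularities.Theorems.MarkedTransferCampaignW46MohWindowShadePolyStatement
import HarnessLib

/-!
# [OURS · L1 W4.6 rung (iii)] The FORMALLY-POLYNOMIAL purely inseparable surface window — res-D-pv-008 AS s46-pv-14's clause (R1) with a
# polynomial normal form: the regime on which this seat's FORMAL entrance door runs, its rung statement, and the «rational singular points»
# conjunct (statement-only typing + pure-logic nesting)

Cell `res-hironaka`, LADDER-RESOLUTION rung L (D-0089), slot W4.6 rung (iii) «purely inseparable `z^p = f(x, y)` with `ord f < 2p`»; seat
res-L1-s46-pv-6 (gen 5). Host route MarkedTransfer (`HypersurfaceOrderReduction`, stmt-ResolutionOfSingularities-16155), `--supports … --as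
helper`; kind definition (TYPED-OURS: 4 definitions + pure-logic nesting). Sibling of this seat's `…MohWindowShadePolyStatement.lean` (p520644,
OURS-desk #215 CLOSED A = B).

WHY. res-D-pv-008 AS res-L1-s46-pv-14's H2-CENSUS (HOME `D/res-D-pv-008/H2-CENSUS.md`) items 8–10 showed that o1's regime of record
`regimeMohWindowSurfaceInsep` (ideal-power reading `f ∈ (x, y)^d · 𝒪`, design point (PUR)) contains isolated window germs with NO formal purely
inseparable presentation, and recommended as the cheapest honest closure of (H2) the clause **(R1)**: «∃ `e : 𝒪̂_ξ ≃+* κ⟦X₀, X₁, X₂⟧` with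
`e(J 𝒪̂_ξ) = (X₂^p + F)`, `F` free of `X₂`» — a condition on the COMPLETE local ring only. Gen 4 of this seat closed the rung for presentations
read in the Zariski local ring (regular system of parameters of `𝒪_{Z,ξ}`, constants `germConst`, `F` polynomial: `Regime.mohWindowSurfacePoly`).
This file types (R1) WITH A POLYNOMIAL `F` (the currency of this seat's kernel termination theorem); gen 5's bricks
`…MohWindowShadeFormal{Anchor,StepCore,StepZChart,Step,Walk}.lean` prove the rung on it over algebraically closed `K`.

WHAT IS TYPED
* `CampaignW46.MohWindowSurfaceFormalPolyAt p K R I` (ring level; `K : Type`, the universe of res-L1-s46-pv-2's formal-chart dictionary which the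
  proofs reuse): for SOME ring isomorphism `e : R̂ ≃+* K⟦z, u₀, u₁⟧` (`R̂` the `𝔪`-adic completion, variables indexed by `Option (Fin 2)`:
  `z = X none`, `u_l = X (some l)`), some generator `I = (f₀)`, some unit `w` and some CLEANED polynomial `F ∈ K[y₀, y₁]` with `p < ord₀ F < 2p`:
  `e(f₀) = w · (z^p + F(u₀, u₁))`. No regular system of parameters of `R`, no constants map `K → R`: the coefficient field is whatever `e` pulls
  back (for a perfect residue field it is the unique one). NOTE (typer's disclosure): by itself the predicate does not imply o1's ring-level
  `MohWindowSurfaceAt p R I` (whose r.s.p. lives in `R`, not `R̂`); the regime below is the CONJUNCTION with o1's regime of record, exactly as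
  for the Poly sibling.
* `CampaignW46.Regime.mohWindowSurfaceFormalPoly` — `regimeMohWindowSurfaceInsep ∧ ∀ ξ ∈ Sing(E), MohWindowSurfaceFormalPolyAt p K 𝒪_{Z,ξ} J_ξ`
  (at EVERY stage; the proof uses it at the root of a hit thread only and TRANSPORTS it — brick `…FormalStep`).
* `CampaignW46.Regime.rationalSing` — «every singular point is `K`-rational»: every germ at `ξ ∈ Sing(E)` is a constant (`germConst`, p520644)
  modulo `𝔪_ξ`. Automatic over algebraically closed `K` (Zariski's lemma); over a perfect non-closed `K` it is the hypothesis under which the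
  gen-5 proof runs verbatim (closer `…FormalTerminates.lean`).
* `CampaignW46.MohWindowSurfaceFormalPolyPermissiblyTerminates p K := PermissiblyTerminates Regime.mohWindowSurfaceFormalPoly` — the résumé-free
  rung: NO infinite §2.1-permissible sequence all of whose stages lie in the regime. PROVED over algebraically closed `K`
  (`…MohWindowShadeFormalTerminates.lean`); implies gen 4's `MohWindowSurfacePolyPermissiblyTerminates` there (Poly ⊆ FormalPoly at rational points,
  proved in the closer file by gen 4's adapted Cohen coordinates), is implied by o1's `MohWindowSurfaceInsepPermissiblyTerminates` (antitonicity,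
  here), and gives the typed forms `Terminates`/`TerminatesNabla` for every `N`, `Rd` (here).

DESIGN POINTS. (UNI) `K : Type`: the formal-chart bricks of res-L1-s46-pv-2 (`…W46RsopAdapted`, `…W46AtomChart*`) are typed at `Type`; a
universe-polymorphic re-typing is mechanical and not needed by any consumer today (same disclosure as o1's (i-a) closure). (IDX) `Option (Fin 2)`
indexing = pv-2's `κ⟦z, u⟧` convention, so that their chart-recognition lemmas apply literally. (CLEAN)/(WIN) cleanedness and the strict window are
part of the normal form as in the Poly sibling; inside the regime they are automatic for any cleaned anchor (brick 1 `window_strict_of_formalAnchor`).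
(VAC) VACUITY SELF-CHECK. Not trivially true: every inhabitant of the Poly regime with rational singular points inhabits this one (closer file,
`Regime.mohWindowSurfacePoly_le_formalPoly`), in particular gen 4's kernel witness `((z^p + x^d + y^d)·𝒪, p)` on `𝔸³` (p522062) over
algebraically closed `K`; NEW inhabitants: germs formally but not Zariski-polynomially purely inseparable, e.g. `z^p + x^(p+1)·(1 + z) + y^(p+1)`
(`X₀ := x·(1+z)^(1/(p+1))` in `𝒪̂`; H2-CENSUS item 8) — membership of that example is NOT proved in the tree (disclosed). Not trivially false:
arbitrarily long in-window chains exist (gen 2). AI-written; AI review is weaker than expert review. H. Hironaka, ms. 2017-03-23, Th. 16.6 p.84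
l.4–20, Th. 16.13 p.87 l.26–28 — scope only, under adjudication, not cited as fact. [Hironaka2017] References: H. Hauser, Bull. AMS 47 (2010)
§§F–G [Hauser2010]; I. S. Cohen, structure theorem (H. Matsumura, *Commutative Ring Theory*, Thm. 28.3) [Matsumura1987].
-/

noncomputable section

set_option linter.dupNamespace false -- mandated namespace of this single-conjunct summit

open CategoryTheory AlgebraicGeometry TopologicalSpace IsLocalRing

namespace Summit.ResolutionOfSingularities.ResolutionOfSingularities.Theorems

namespace CampaignW46

open Literature.AlgebraicGeometry.Resolution
open Literature.AlgebraicGeometry.Resolution.Hauser2010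
open Literature.AlgebraicGeometry.Hironaka2017.S02Preliminaries
open Literature.AlgebraicGeometry.Hironaka2017.Datum

variable {p : ℕ} [Fact p.Prime] {K : Type} [Field K] [CharP K p]

/-! ## §1 The formally-polynomial purely inseparable window (ring level) -/

/-- [OURS · L1 W4.6 rung (iii)] replaces the role of the hypothesis «purely inseparable SURFACE `z^p = F(x, y)`, `F` a polynomial with
`p < ord F < 2p`» (RESCUE-SEED W4.6 (iii)) READ IN THE COMPLETION — res-D-pv-008 AS s46-pv-14's clause (R1) with a polynomial normal form; NOT a
statement of the manuscript. For a local ring `R` (= `𝒪_{Z,ξ}`) and an ideal `I` (= `J_ξ`): for SOME ring isomorphism `e` of the `𝔪`-adic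
completion `R̂` with `K⟦z, u₀, u₁⟧` (`z = X none`, `u_l = X (some l)`), some `f₀` with `I = (f₀)`, some unit `w` and some CLEANED polynomial
`F ∈ K[y₀, y₁]` (`deletePthPowers p F = F`) with `p < ord₀ F < 2p`: `e(f₀) = w · (z^p + F(u₀, u₁))`. [cite: Hauser2010, §F (setting f = x^p + y^r g), §G (cleaning of p-th power monomials)] -/
def MohWindowSurfaceFormalPolyAt (p : ℕ) (K : Type) [Field K] (R : Type) [CommRing R] [IsLocalRing R] (I : Ideal R) : Prop :=
  ∃ (e : AdicCompletion (maximalIdeal R) R ≃+* MvPowerSeries (Option (Fin 2)) K) (f₀ : R) (w : MvPowerSeries (Option (Fin 2)) K)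
    (F : MvPolynomial (Fin 2) K),
    deletePthPowers p F = F ∧ (p : ℕ∞) < ordZero F ∧ ordZero F < (2 * p : ℕ) ∧ I = Ideal.span {f₀} ∧ IsUnit w ∧
      e (algebraMap R (AdicCompletion (maximalIdeal R) R) f₀) =
        w * (MvPowerSeries.X none ^ p + MvPolynomial.eval₂ MvPowerSeries.C
          (fun l : Fin 2 => if l = (0 : Fin 2) then MvPowerSeries.X (some (0 : Fin 2)) else MvPowerSeries.X (some 1)) F)

/-! ## §2 The regimes -/

/-- [OURS · L1 W4.6 rung (iii)] **Regime «FORMALLY-POLYNOMIAL purely inseparable surface window»** — replaces the role of the restriction (iii)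
of RESCUE-SEED W4.6 in dimension 3 in its strict normal form READ IN THE COMPLETED LOCAL RINGS, on the state `(Z, E)` at EVERY stage; NOT a
statement of the manuscript: o1's regime of record `regimeMohWindowSurfaceInsep` (isolated singular locus of closed points, surface window germ of
exponent `E.b = p` at every singular point) AND, at every `ξ ∈ Sing(E)`, `MohWindowSurfaceFormalPolyAt p K 𝒪_{Z,ξ} J_ξ`. [folklore] -/
def Regime.mohWindowSurfaceFormalPoly : Regime p K := fun A E =>
  regimeMohWindowSurfaceInsep A E ∧ ∀ ξ ∈ E.sing, MohWindowSurfaceFormalPolyAt p K (A.Z.presheaf.stalk ξ) (stalkIdeal E.J ξ)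

/-- [OURS · L1 W4.6] **Regime conjunct «every singular point is `K`-rational»** — replaces the role of «`K` algebraically closed» in this seat's
rung proofs by the property they use; NOT a statement of the manuscript: at every `ξ ∈ Sing(E)` every germ is a constant modulo `𝔪_ξ`
(`germConst`, p520644). [cite: StacksProject, Tag 0CY7] -/
def Regime.rationalSing : Regime p K := fun A E =>
  ∀ ξ ∈ E.sing, ∀ ρ : A.Z.presheaf.stalk ξ, ∃ l : K, ρ - germConst A ξ l ∈ maximalIdeal (A.Z.presheaf.stalk ξ)

/-- Pure logic: the formally-polynomial regime is a sub-regime of o1's regime of record. [folklore] -/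
theorem Regime.mohWindowSurfaceFormalPoly_le (A : AmbientDatum p K) (E : IdealExponent A.Z) (h : Regime.mohWindowSurfaceFormalPoly A E) :
    regimeMohWindowSurfaceInsep A E :=
  h.1

/-! ## §3 The rung -/

/-- [OURS · L1 W4.6 rung (iii)] **RUNG (iii), FORMALLY-POLYNOMIAL PURELY INSEPARABLE SURFACE WINDOW, résumé-free** — replaces the role of the
termination clause of Th. 16.13 p.87 l.26–28 («repeatedly but finitely many times») for the typed Th. 16.6 procedure restricted, at every stage, to
`Regime.mohWindowSurfaceFormalPoly`; NOT a statement of the manuscript: there is NO infinite §2.1-permissible sequence (standard ideal exponents,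
permissible centres — here single closed points —, blow-ups, controlled transforms) all of whose stages lie in the regime (`PermissiblyTerminates`).
PROVED over algebraically closed `K` by this seat's gen-5 assembly (`…MohWindowShadeFormalTerminates.lean`). VACUITY: module docstring (VAC).
[folklore] -/
def MohWindowSurfaceFormalPolyPermissiblyTerminates (p : ℕ) [Fact p.Prime] (K : Type) [Field K] [CharP K p] : Prop :=
  PermissiblyTerminates (Regime.mohWindowSurfaceFormalPoly (p := p) (K := K))

/-- Pure logic (antitonicity in the regime): o1's rung `MohWindowSurfaceInsepPermissiblyTerminates` implies the formally-polynomial rung.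
[folklore] -/
theorem mohWindowSurfaceFormalPolyPermissiblyTerminates_of_insep (h : MohWindowSurfaceInsepPermissiblyTerminates p K) :
    MohWindowSurfaceFormalPolyPermissiblyTerminates p K :=
  permissiblyTerminates_antitone (fun A E hAE => Regime.mohWindowSurfaceFormalPoly_le A E hAE) h

/-- **The typed rungs from the résumé-free rung**: for EVERY notion instance `N` and reading `Rd`, the typed Th. 16.6 procedure with the literal
centre rule (`Terminates`) and the ∇-centred one (`TerminatesNabla`) have no infinite run inside the formally-polynomial surface window regime.
[folklore] -/
theorem terminates_and_terminatesNabla_of_mohWindowSurfaceFormalPolyPermissiblyTerminates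
    (h : MohWindowSurfaceFormalPolyPermissiblyTerminates p K) (n : ℕ) (N : Notions.{0} n) (Rd : Reading p K N) :
    Terminates N Rd (Regime.mohWindowSurfaceFormalPoly (p := p) (K := K)) ∧
      TerminatesNabla N Rd (Regime.mohWindowSurfaceFormalPoly (p := p) (K := K)) :=
  ⟨terminates_of_permissiblyTerminates N Rd h, terminatesNabla_of_terminates (terminates_of_permissiblyTerminates N Rd h)⟩

/-- Pure logic: the rung on a regime gives the rung on its intersection with «rational singular points» (and with any other conjunct).
[folklore] -/
theorem permissiblyTerminates_inter_rationalSing {Rg : Regime p K} (h : PermissiblyTerminates Rg) :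
    PermissiblyTerminates (Regime.inter Rg (Regime.rationalSing (p := p) (K := K))) :=
  permissiblyTerminates_antitone (fun _ _ hAE => hAE.1) h

end CampaignW46

end Summit.ResolutionOfSingularities.ResolutionOfSingularities.Theorems

end
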